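import Mathlib
import Literature.Computability.Complexity.RangeAvoidance
import Literature.Computability.Complexity.SignDegreeXor
import Summits.PneNP.PneNP.Theorems.PstarPDT
import Summits.PneNP.PneNP.Theorems.PstarFibrePolys
import Summits.PneNP.PneNP.Theorems.PstarSALevel
import Summits.PneNP.PneNP.Theorems.PstarTyped
import Summits.PneNP.PneNP.Theorems.PstarGapLinearised
import Summits.PneNP.PneNP.Theorems.PstarGapPeeling
import Summits.PneNP.PneNP.Theorems.PstarCentreFree
import Summits.PneNP.PneNP.Theorems.PstarGraphQuadGapTwoForms
import Summits.PneNP.PneNP.Theorems.PstarGapOneAll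
import Summits.PneNP.PneNP.Theorems.PstarGConstraint

/-!
# The reader-graph induction: reductions (a), (b) and the free-variable case (ROUND-24 item T24.17′, steps)

FRONTIER range-avoidance ladder, rung F-N3, ROUND 24 (cell `pnp-ideate`; restricted-model proof complexity — nothing here bears on
`P` versus `NP`).  Steps of the proof of `PstarGapOneAll.GSat` (memo ROUND-24-PRESEED §13 R10(p); referee AUDIT-r10p-gsat-g43),
stated as lemmas CONTRADICTING the standing assumption

  `hunsat : ∀ z, (∀ j ∈ J, I.eval z j = y j) → gval I C G z ≠ b`

of the inductive step, given the induction hypothesis `ih` for `J.erase g` (all legal G-constraints).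

* `step_free` (referee P7): a variable of `C` read by no output of `J` and by no AND pair of `G` — flip it in a solution of `J`
  (peeling supplies one).
* `step_xor` (memo (a)): an output `g ∈ J` with an XOR slot `t ∉ C` read by no other output of `J` — solve `J ∖ g` with the constraint
  by `ih`, flip `t` if `g` is wrong (`gval` does not see `t`: typed).
* `step_reader` (memo (b)): an output `g ∈ J` whose two XOR slots `t, t' ∈ C` are read by no other output of `J` — move `g` into `G`:
  `ih` on `J ∖ g` with `(C ∆ {t,t'}, G ∪ {g}, b ⊕ y_g)` (non-constant since it has a monomial; `PstarGConstraint.gval_reader`), then flip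
  `t` to repair `g` (`t ∉ C ∆ {t,t'}`).
-/

set_option linter.dupNamespace false -- `Summit.PneNP.PneNP.…`: summit = sub-problem name (D-0017 single-conjunct layout)

open Finset Literature.Computability.Complexity
open scoped symmDiff
open Summit.PneNP.PneNP.Theorems.PstarPDT (parity)
open Summit.PneNP.PneNP.Theorems.PstarFibrePolys (bit bit_injective)
open Summit.PneNP.PneNP.Theorems.PstarTyped (Typed)
open Summit.PneNP.PneNP.Theorems.PstarSALevel (varSet bdry BoundaryExpanding SimpleOverlap)
open Summit.PneNP.PneNP.Theorems.PstarGapLinearised (andPair)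
open Summit.PneNP.PneNP.Theorems.PstarGapPeeling (eval_update_of_not_mem eval_update_xor_slot feasible_of_boundaryExpanding)
open Summit.PneNP.PneNP.Theorems.PstarCentreFree (vars_mem_varSet)
open Summit.PneNP.PneNP.Theorems.PstarGapOneAll (gval)
open Summit.PneNP.PneNP.Theorems.PstarGConstraint

namespace Summit.PneNP.PneNP.Theorems.PstarGSatSteps

variable {n m : ℕ}

section Steps

variable (I : LocalMap 4 n m) (hI : I.IsPure xorAndPred) (hT : Typed I) (hS : SimpleOverlap I) (y : Fin m → Bool)
  (J G : Finset (Fin m)) (C : Finset (Fin n)) (b : Bool) (hJG : Disjoint J G)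
  (hunsat : ∀ z : Fin n → Bool, (∀ j ∈ J, I.eval z j = y j) → gval I C G z ≠ b)
  (ih : ∀ g ∈ J, ∀ (G' : Finset (Fin m)) (C' : Finset (Fin n)) (b' : Bool), Disjoint (J.erase g) G' →
    (∃ z z' : Fin n → Bool, gval I C' G' z ≠ gval I C' G' z') →
      ∃ z : Fin n → Bool, (∀ j ∈ J.erase g, I.eval z j = y j) ∧ gval I C' G' z = b')

include hunsat

/-- **Free variable of `C` (referee P7).**  Given any solution of `J`. -/
theorem step_free {z₀ : Fin n → Bool} (hz₀ : ∀ j ∈ J, I.eval z₀ j = y j) {v : Fin n} (hvC : v ∈ C)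
    (hvJ : ∀ j ∈ J, v ∉ varSet I j) (hvG : ∀ g ∈ G, I.vars g 2 ≠ v ∧ I.vars g 3 ≠ v) : False := by
  classical
  by_cases h0 : gval I C G z₀ = b
  · exact hunsat z₀ hz₀ h0
  refine hunsat (Function.update z₀ v (!z₀ v)) (fun j hj => ?_) ?_
  · rw [eval_update_of_not_mem I j z₀ (hvJ j hj)]
    exact hz₀ j hj
  · apply bit_injective
    have e : bit (gval I C G (Function.update z₀ v (!z₀ v))) = bit (gval I C G z₀) + 1 := by
      rw [bit_gval, bit_gval]
      have hC : ∑ w ∈ C, bit (Function.update z₀ v (!z₀ v) w) = ∑ w ∈ C, bit (z₀ w) + 1 := by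
        have key : ∀ w ∈ C, bit (Function.update z₀ v (!z₀ v) w) = bit (z₀ w) + if w = v then 1 else 0 := by
          intro w _
          by_cases h : w = v
          · subst h
            rw [Function.update_self, if_pos rfl]
            cases z₀ w <;> decide
          · rw [Function.update_of_ne h, if_neg h, add_zero]
        rw [sum_congr rfl key, sum_add_distrib, sum_ite_eq' C v, if_pos hvC]
      have hG : ∑ g ∈ G, bit (Function.update z₀ v (!z₀ v) (I.vars g 2)) * bit (Function.update z₀ v (!z₀ v) (I.vars g 3)) =
          ∑ g ∈ G, bit (z₀ (I.vars g 2)) * bit (z₀ (I.vars g 3)) :=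
        sum_congr rfl fun g hg => by rw [Function.update_of_ne (hvG g hg).1, Function.update_of_ne (hvG g hg).2]
      rw [hC, hG]
      ring
    rw [e]
    revert h0
    cases gval I C G z₀ <;> cases b <;> decide

include hI hT hJG ih

/-- **Reduction (a): a private XOR slot outside `C`.** -/
theorem step_xor (hnc : ∃ z z' : Fin n → Bool, gval I C G z ≠ gval I C G z') {g : Fin m} (hg : g ∈ J) {s : Fin 4}
    (hs : s.val < 2) (hpriv : ∀ g' ∈ J, g' ≠ g → I.vars g s ∉ varSet I g') (htC : I.vars g s ∉ C) : False := by
  classical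
  have hdis : Disjoint (J.erase g) G := disjoint_of_subset_left (erase_subset _ _) hJG
  obtain ⟨z, hz, hzb⟩ := ih g hg G C b hdis hnc
  by_cases hok : I.eval z g = y g
  · exact hunsat z (fun j hj => if h : j = g then by rw [h]; exact hok else hz j (mem_erase.2 ⟨h, hj⟩)) hzb
  refine hunsat (Function.update z (I.vars g s) (!z (I.vars g s))) (fun j hj => ?_) ?_
  · by_cases h : j = g
    · subst h
      rw [eval_update_xor_slot I hI z j s hs]
      revert hok
      cases I.eval z j <;> cases y j <;> simp
    · rw [eval_update_of_not_mem I j z (hpriv j hj h)]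
      exact hz j (mem_erase.2 ⟨h, hj⟩)
  · rw [gval_update_of_forall_ne I z htC (fun g' _ => ⟨fun h => hT g g' s 2 hs (by decide) h.symm,
      fun h => hT g g' s 3 hs (by decide) h.symm⟩)]
    exact hzb

include hS

/-- **Reduction (b): a reader** — both XOR slots private (and in `C`). -/
theorem step_reader {g : Fin m} (hg : g ∈ J)
    (hpriv0 : ∀ g' ∈ J, g' ≠ g → I.vars g 0 ∉ varSet I g') (hpriv1 : ∀ g' ∈ J, g' ≠ g → I.vars g 1 ∉ varSet I g')
    (h0C : I.vars g 0 ∈ C) (h1C : I.vars g 1 ∈ C) : False := by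
  classical
  have hgG : g ∉ G := fun h => disjoint_left.1 hJG hg h
  have hdis : Disjoint (J.erase g) (insert g G) := by
    rw [disjoint_insert_right]
    exact ⟨notMem_erase g J, disjoint_of_subset_left (erase_subset _ _) hJG⟩
  -- the new constraint has a monomial, hence is non-constant
  obtain ⟨hnd, hdist⟩ := andPairs_simple I hI hS (insert g G)
  have hnc' : ∃ z z' : Fin n → Bool, gval I (C ∆ {I.vars g 0, I.vars g 1}) (insert g G) z ≠
      gval I (C ∆ {I.vars g 0, I.vars g 1}) (insert g G) z' :=
    (gval_nonconst_iff I hnd hdist).2 (Or.inr (insert_ne_empty g G))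
  obtain ⟨z, hz, hzb⟩ := ih g hg (insert g G) (C ∆ {I.vars g 0, I.vars g 1}) (xor b (y g)) hdis hnc'
  -- `t ∉ C ∆ {t,t'}`
  have ht : I.vars g 0 ∉ C ∆ {I.vars g 0, I.vars g 1} := by
    rw [mem_symmDiff]
    push Not
    exact ⟨fun _ => mem_insert_self _ _, fun _ => h0C⟩
  by_cases hok : I.eval z g = y g
  · refine hunsat z (fun j hj => if h : j = g then by rw [h]; exact hok else hz j (mem_erase.2 ⟨h, hj⟩)) ?_
    have e := gval_reader I hI C hgG z
    rw [hzb, hok] at e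
    revert e
    cases gval I C G z <;> cases b <;> cases y g <;> decide
  · refine hunsat (Function.update z (I.vars g 0) (!z (I.vars g 0))) (fun j hj => ?_) ?_
    · by_cases h : j = g
      · subst h
        rw [eval_update_xor_slot I hI z j 0 (by decide)]
        revert hok
        cases I.eval z j <;> cases y j <;> simp
      · rw [eval_update_of_not_mem I j z (hpriv0 j hj h)]
        exact hz j (mem_erase.2 ⟨h, hj⟩)
    · have e := gval_reader I hI C hgG (Function.update z (I.vars g 0) (!z (I.vars g 0)))
      rw [gval_update_of_forall_ne I z ht (fun g' _ => ⟨fun h => hT g g' 0 2 (by decide) (by decide) h.symm,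
        fun h => hT g g' 0 3 (by decide) (by decide) h.symm⟩), hzb, eval_update_xor_slot I hI z g 0 (by decide)] at e
      revert e hok
      cases gval I C G (Function.update z (I.vars g 0) (!z (I.vars g 0))) <;> cases b <;> cases y g <;>
        cases I.eval z g <;> decide

end Steps

end Summit.PneNP.PneNP.Theorems.PstarGSatSteps
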